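import Mathlib
import Literature.AlgebraicGeometry.Resolution.CobordantGame
import Literature.AlgebraicGeometry.Resolution.FormalCoordinateChange
import Literature.AlgebraicGeometry.Resolution.WeightedShear
import Literature.AlgebraicGeometry.Resolution.PlaneGermBlowup
import Summits.ResolutionOfSingularities.ResolutionOfSingularities.Theorems.WeightedInvariantGlobalizeLocalDropCanonize
import Summits.ResolutionOfSingularities.ResolutionOfSingularities.Theorems.WeightedInvariantGlobalizeLocalDropCylinder
import Summits.ResolutionOfSingularities.ResolutionOfSingularities.Theorems.WeightedInvariantLocalWeightedDropPlaneBranchDropOfCount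
import Summits.ResolutionOfSingularities.ResolutionOfSingularities.Theorems.WeightedInvariantLocalWeightedDropSeparableNCReduction

/-!
# `WeightedInvariant.LocalWeightedDrop`, line `hasse-ridge-face-selection`: REDUCTION OF THE SEPARABLE char-2 DOUBLE POINTS TO A
# MONOMIAL LINEAR COEFFICIENT `A₁ = x₀^a x₁^b · V`, `V(0) ≠ 0`

Crux item stmt-ResolutionOfSingularities-8899 `LocalWeightedDrop` (route `ResolutionOfSingularities/WeightedInvariant`), serving the
door `WeightedConstruction` stmt-ResolutionOfSingularities-0571.  [OURS · L1 W4.3, chain w43, stub worker 2 (gen 2): third unit of the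
reduction piece S2sM `stub_charTwoSeparableReductionWon` (typed sub-cut of S2s, evidence #56 on stmt-8899); NOT a statement of any
manuscript.]

* `won_dp1_subst_iff`: a formal coordinate change `Φ` of the `x`-plane acts on monic double points by
  `(A₀, A₁) ↦ (A₀ ∘ Φ, A₁ ∘ Φ)` and does not change winnability (the mirrored move `Φ ⊗ id`, `won_subst_iff`).
* `sepWon_of_monomialWon` (characteristic `2`, `k = k̄`; only the singular one-variable germs assumed won): IF every position
  `y² + x₀^a x₁^b·V·y + A₀` (`V(0) ≠ 0`, `a + b ≥ 2`, `ord A₀ ≥ 3`) is won THEN every separable position (`A₁ ≠ 0`) is won —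
  `SepNCReduction.sepWon_of_ncWon` (embedded resolution of the plane curve `A₁ = 0`) followed by the coordinate change that makes the
  normal-crossing support of `A₁` literal.  `charTwoSeparableReduction_of_monomialWon` is the same in the stub's quantifier shape.
The residual class — a double point whose `∂f/∂y` is a MONOMIAL times a unit — is the separable counterpart of Hauser–Perlega's
purely inseparable setting (there `∂f/∂y = 0`); its resolution (HP 2024 §§8–9 with the boundary `{x₀x₁ = 0} ⊇ {A₁ = 0}`) is what
remains of S2sM.
-/

set_option linter.dupNamespace false -- mandated namespace of this single-conjunct summit

namespace Summit.ResolutionOfSingularities.ResolutionOfSingularities.Theorems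

open Literature.AlgebraicGeometry.Resolution
open Literature.AlgebraicGeometry.Resolution.CobordantGame

namespace SepMonoReduction

open MvPowerSeries

variable {k : Type} [Field k]

/-- The mirrored coordinate change `Φ ⊗ id` (`Φ` on `x₀, x₁`, identity on `y = X (Fin.last 2)`) maps the monic double point
`y² + A₀♮ + A₁♮ y` to `y² + (A₀ ∘ Φ)♮ + (A₁ ∘ Φ)♮ y`. -/
theorem subst_cylMove_dp1 (Φ : Fin 2 → MvPowerSeries (Fin 2) k) (hΦ0 : ∀ i, constantCoeff (Φ i) = 0)
    (A₀ A₁ : MvPowerSeries (Fin 2) k) :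
    subst (Fin.insertNth (α := fun _ => MvPowerSeries (Fin 3) k) (Fin.last 2) (X (Fin.last 2))
        (fun m => rename (Fin.succAboveEmb (Fin.last 2)) (Φ m)))
      (X (Fin.last 2) ^ 2 + (rename (Fin.succAboveEmb (Fin.last 2)) A₀ +
        rename (Fin.succAboveEmb (Fin.last 2)) A₁ * X (Fin.last 2))) =
      X (Fin.last 2) ^ 2 + (rename (Fin.succAboveEmb (Fin.last 2)) (subst Φ A₀) +
        rename (Fin.succAboveEmb (Fin.last 2)) (subst Φ A₁) * X (Fin.last 2)) := by
  have hs := hasSubst_of_constantCoeff_zero (constantCoeff_cylMove (Fin.last 2) Φ hΦ0)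
  rw [← coe_substAlgHom hs, map_add, map_add, map_mul, map_pow, coe_substAlgHom, subst_X hs,
    Fin.insertNth_apply_same, subst_cylMove_rename (Fin.last 2) Φ hΦ0 A₀, subst_cylMove_rename (Fin.last 2) Φ hΦ0 A₁]

/-- A FORMAL COORDINATE CHANGE OF THE `x`-PLANE DOES NOT CHANGE WINNABILITY of a monic double point:
`y² + (A₀∘Φ)♮ + (A₁∘Φ)♮ y` is won iff `y² + A₀♮ + A₁♮ y` is. -/
theorem won_dp1_subst_iff (Φ : Fin 2 → MvPowerSeries (Fin 2) k) (hΦ0 : ∀ i, constantCoeff (Φ i) = 0)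
    (hdet : IsUnit (Matrix.det (Matrix.of fun i j => coeff (Finsupp.single j 1) (Φ i))))
    (A₀ A₁ : MvPowerSeries (Fin 2) k) :
    CobordantGame.Won k 3 (X (Fin.last 2) ^ 2 + (rename (Fin.succAboveEmb (Fin.last 2)) (subst Φ A₀) +
        rename (Fin.succAboveEmb (Fin.last 2)) (subst Φ A₁) * X (Fin.last 2))) ↔
      CobordantGame.Won k 3 (X (Fin.last 2) ^ 2 + (rename (Fin.succAboveEmb (Fin.last 2)) A₀ +
        rename (Fin.succAboveEmb (Fin.last 2)) A₁ * X (Fin.last 2))) := by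
  rw [← subst_cylMove_dp1 Φ hΦ0 A₀ A₁]
  refine won_subst_iff (constantCoeff_cylMove (Fin.last 2) Φ hΦ0) ?_ _
  unfold FormalCoordChange.linMat
  rw [det_linMat_cylMove]
  exact hdet

/-- REDUCTION TO A MONOMIAL LINEAR COEFFICIENT (characteristic `2`, `k = k̄`; only the singular one-variable germs assumed won): if
every position `y² + x₀^a x₁^b·V·y + A₀` (`V(0) ≠ 0`, `a + b ≥ 2`, `ord A₀ ≥ 3`) is won, then every separable position is won. -/
theorem sepWon_of_monomialWon [CharP k 2] [IsAlgClosed k]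
    (hlow : ∀ g : MvPowerSeries (Fin 1) k, CobordantGame.IsSingular k g → CobordantGame.Won k 1 g)
    (hMono : ∀ (A₀ V : MvPowerSeries (Fin 2) k) (a b : ℕ), (2 : ℕ∞) < A₀.order → 2 ≤ a + b → constantCoeff V ≠ 0 →
      CobordantGame.Won k 3 (X (Fin.last 2) ^ 2 + (rename (Fin.succAboveEmb (Fin.last 2)) A₀ +
        rename (Fin.succAboveEmb (Fin.last 2)) (X 0 ^ a * X 1 ^ b * V) * X (Fin.last 2)))) :
    ∀ A₀ A₁ : MvPowerSeries (Fin 2) k, (2 : ℕ∞) < A₀.order → (1 : ℕ∞) < A₁.order → A₁ ≠ 0 →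
      CobordantGame.Won k 3 (X (Fin.last 2) ^ 2 + (rename (Fin.succAboveEmb (Fin.last 2)) A₀ +
        rename (Fin.succAboveEmb (Fin.last 2)) A₁ * X (Fin.last 2))) := by
  refine SepNCReduction.sepWon_of_ncWon hlow fun A₀ A₁ h₀ h₁ _ hnc => ?_
  obtain ⟨Φ, u, a, c, hΦ0, hdet, hu, hΦA₁⟩ := hnc
  rw [← won_dp1_subst_iff Φ hΦ0 hdet, hΦA₁, show u * X 0 ^ a * X 1 ^ c = X 0 ^ a * X 1 ^ c * u by ring]
  refine hMono _ u a c ?_ ?_ hu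
  · rw [WeightedShear.order_subst_of_isUnit_det hΦ0 hdet]
    exact h₀
  · have hord : (subst Φ A₁).order = ((a + c : ℕ) : ℕ∞) := by
      rw [hΦA₁]; exact PlaneBranchDropOfCount.order_unit_monomial hu a c
    rw [WeightedShear.order_subst_of_isUnit_det hΦ0 hdet] at hord
    have h : (1 : ℕ∞) < ((a + c : ℕ) : ℕ∞) := by rw [← hord]; exact h₁
    have h' : 1 < a + c := by exact_mod_cast h
    omega

end SepMonoReduction

open SepMonoReduction MvPowerSeries in
/-- S2sM REDUCED TO THE MONOMIAL-`A₁` CLASS (in the quantifier shape of the proposed stub `stub_charTwoSeparableReductionWon`, evidence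
#56 on stmt-8899).  Over an algebraically closed field of characteristic `2`, given the singular germs in `≤ 2` variables: if every
monic germ `y² + x₀^a x₁^b·V·y + A₀` (`V(0) ≠ 0`, `a + b ≥ 2`, `ord A₀ ≥ 3`) is won, then every monic germ `y² + A₁ y + A₀` with
`ord A₀ ≥ 3`, `ord A₁ ≥ 2`, `A₁ ≠ 0` is won.  [OURS · L1 W4.3.] -/
theorem charTwoSeparableReduction_of_monomialWon (k : Type) [Field k] [CharP k 2] [IsAlgClosed k]
    (hlow : ∀ m : ℕ, m < 3 → ∀ g : MvPowerSeries (Fin m) k, CobordantGame.IsSingular k g → CobordantGame.Won k m g)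
    (hMono : ∀ (A₀ V : MvPowerSeries (Fin 2) k) (a b : ℕ), (2 : ℕ∞) < A₀.order → 2 ≤ a + b →
      MvPowerSeries.constantCoeff V ≠ 0 →
      CobordantGame.Won k 3 (MvPowerSeries.X (Fin.last 2) ^ 2 + (MvPowerSeries.rename (Fin.succAboveEmb (Fin.last 2)) A₀ +
        MvPowerSeries.rename (Fin.succAboveEmb (Fin.last 2))
          (MvPowerSeries.X 0 ^ a * MvPowerSeries.X 1 ^ b * V) * MvPowerSeries.X (Fin.last 2)))) :
    ∀ A₀ A₁ : MvPowerSeries (Fin 2) k, (2 : ℕ∞) < A₀.order → (1 : ℕ∞) < A₁.order → A₁ ≠ 0 →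
      CobordantGame.Won k 3 (MvPowerSeries.X (Fin.last 2) ^ 2 + (MvPowerSeries.rename (Fin.succAboveEmb (Fin.last 2)) A₀ +
        MvPowerSeries.rename (Fin.succAboveEmb (Fin.last 2)) A₁ * MvPowerSeries.X (Fin.last 2))) :=
  sepWon_of_monomialWon (hlow 1 (by norm_num)) hMono

end Summit.ResolutionOfSingularities.ResolutionOfSingularities.Theorems
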